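import Summits.QuantumAdvantage.QuantumAdvantage.Theorems.CubicForrelationSignedExactSliceIsLiftDefs
import Literature.Computability.QuantumComplexity.SignedForrelationMem

/-!
# Stub `stub_glue` of line `Sketch` (crux K2 `SignedExactSliceIsLift`, stmt-QuantumAdvantage-14830)

The lead's glue of the reduce-then-lift line: FROM the RM(3) Möbius algebra (stub M: the truncated interpolant
`truncOf n F` of any oracle is cubic, and equals `f` on a cubic `f`), the canonical netlists (stub E: circuits
`E n mons` over `B₂` computing `evalMonos`, reading every input wire, with mirror `anfPC`) and the front-end
certificate (stub F₃: `x ↦ instE (canonMirror x)` is polynomial time on every string) TO the total canonicaliser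
(stub C): the string function is total into the promise of `gappedSlice` and maps exact yes/no codes correctly.

Proof. `instE (canonMirror x)` is the code of a GENUINE instance built from the circuits `E` — under the guard the
two-circuit instance `⟨n, 2, (E n mons₀, E n mons₁)⟩` of the interpolants' netlists, otherwise the fixed
`⟨0, 2, (E 0 [], E 0 [])⟩` (`ForrCode.encode_eq`, clause (d) of stub E); both are in `WF` on EVERY string (`B₂` by (a);
`k = 2`; `n` even by the guard; cubic by (b) + stub M (i); `n ≤ #R + 1` because circuit `0` reads every input wire, (c));
hence the image is a yes-code iff its value is `1` and a no-code otherwise. On an exact code `I.encode` the parser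
returns the mirror of `I` (`parse_instE`), the guard passes (`SgnForrMem.n_le_of_promise`, `ForrMem.sR_le_length`), the
emitted circuits compute the interpolants of `(I.C i).eval`, which ARE `(I.C i).eval` (stub M (ii), cubic by
hypothesis), so the value is preserved (`KForrelationInstance.value_eq_forrelation`, `kForrelationValue_fin_two`).
No definitions are introduced (the two instances are written out), so the file is kernel-checked only.
-/

set_option linter.dupNamespace false -- D-0017: single-problem summit ⇒ `QuantumAdvantage.QuantumAdvantage` by design

noncomputable section

namespace Summit.QuantumAdvantage.QuantumAdvantage.Theorems.SignedExactSliceIsLift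

open _root_.Computability Literature.Computability.Complexity Literature.Computability.Cryptography
  Literature.Computability.QuantumComplexity
open Literature.Computability.Complexity.CodeFP (strE unE natE bitE pairE rawE)
open Summit.QuantumAdvantage.QuantumAdvantage.Theses.CubicForrelation (NearExactIsExact SignedExactSliceIsLift)

namespace StubGlue

open ForrCode Literature.Computability.Complexity.Brick

/-! ### The parser inverts the mirror code -/

/-- `parseWire` inverts `wireE`. -/
theorem parseWire_wireE (w : Wire) : parseWire (wireE w) = w := by
  obtain ⟨b, m⟩ := w
  simp [parseWire, wireE]

/-- `parseGate` inverts `pgE`. -/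
theorem parseGate_pgE (g : PGate) : parseGate (pgE g) = g := by
  obtain ⟨tt, ws⟩ := g
  rw [parseGate]
  simp only [CodeFP.pairE_apply, fstF_boolPair, sndF_boolPair, CodeFP.decNil_rawE, List.map_map]
  refine Prod.ext rfl ?_
  simp only
  conv_rhs => rw [← List.map_id ws]
  exact List.map_congr_left fun w _ => parseWire_wireE w

/-- `parsePC` inverts `pcE`. -/
theorem parsePC_pcE (c : PCirc) : parsePC (pcE c) = c := by
  obtain ⟨gs, w⟩ := c
  rw [parsePC]
  simp only [CodeFP.pairE_apply, fstF_boolPair, sndF_boolPair, CodeFP.decNil_rawE, List.map_map, parseWire_wireE]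
  refine Prod.ext ?_ rfl
  simp only
  conv_rhs => rw [← List.map_id gs]
  exact List.map_congr_left fun g _ => parseGate_pgE g

/-- **`parse` inverts `instE`.** -/
theorem parse_instE (t : Inst) : parse (instE t) = t := by
  obtain ⟨n, k, cs⟩ := t
  rw [parse]
  simp only [CodeFP.pairE_apply, fstF_boolPair, sndF_boolPair, CodeFP.decNil_rawE, List.map_map,
    CodeFP.bitsToNat_natE]
  refine Prod.ext rfl (Prod.ext rfl ?_)
  simp only
  conv_rhs => rw [← List.map_id cs]
  exact List.map_congr_left fun c _ => parsePC_pcE c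

/-- On a genuine instance code the parser returns the mirror instance. -/
theorem parse_encode (I : KForrelationInstance) : parse I.encode = instOf I := by
  rw [encode_eq, parse_instE]

/-! ### The genuine instances behind the canonical mirror -/

variable {E : (n : ℕ) → List (List ℕ) → Circuit (Fin n)}
variable (hmirror : ∀ n mons, pcircOf (E n mons) = anfPC n mons)

include hmirror in
/-- The code of the guarded two-circuit instance is the guarded branch of `canonOf`. -/
theorem instE_guarded (t : Inst) :
    (⟨t.1, 2, ![E t.1 (cubicMonomials t.1 (evalP (circAt t 0))),
        E t.1 (cubicMonomials t.1 (evalP (circAt t 1)))]⟩ : KForrelationInstance).encode =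
      instE (t.1, 2, [anfPC t.1 (cubicMonomials t.1 (evalP (circAt t 0))),
        anfPC t.1 (cubicMonomials t.1 (evalP (circAt t 1)))]) := by
  rw [encode_eq]
  simp only [instOf, List.ofFn_succ, List.ofFn_zero, Matrix.cons_val_zero, Matrix.cons_val_succ,
    Matrix.cons_val_fin_one, hmirror]

include hmirror in
/-- The code of the junk instance is the junk branch of `canonOf`. -/
theorem instE_junk : (⟨0, 2, ![E 0 [], E 0 []]⟩ : KForrelationInstance).encode = instE (0, 2, [anfPC 0 [], anfPC 0 []]) := by
  rw [encode_eq]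
  simp only [instOf, List.ofFn_succ, List.ofFn_zero, Matrix.cons_val_zero, Matrix.cons_val_succ,
    Matrix.cons_val_fin_one, hmirror]

include hmirror in
/-- **The canonicaliser's output is the code of a genuine instance** (guarded or junk). -/
theorem instE_canonMirror (x : List Bool) : instE (canonMirror x) =
    (if guardOK (parse x) x.length then
      (⟨(parse x).1, 2, ![E (parse x).1 (cubicMonomials (parse x).1 (evalP (circAt (parse x) 0))),
        E (parse x).1 (cubicMonomials (parse x).1 (evalP (circAt (parse x) 1)))]⟩ : KForrelationInstance)
     else ⟨0, 2, ![E 0 [], E 0 []]⟩).encode := by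
  unfold canonMirror canonOf
  split_ifs with hg
  · rw [instE_guarded hmirror]
  · rw [instE_junk hmirror]

/-! ### Well-formedness on every string -/

/-- If circuit `0` of a two-circuit instance reads every input wire then `n ≤ #R`. -/
theorem n_le_sR {n : ℕ} (C : Fin 2 → Circuit (Fin n)) (h : ∀ j, j < n → j ∈ ForrMem.readsC (C 0)) :
    n ≤ ForrMem.sR (⟨n, 2, C⟩ : KForrelationInstance) := by
  set I : KForrelationInstance := ⟨n, 2, C⟩ with hI
  have hocc : ∀ j, j < n → j ∈ ForrMem.occList I := by
    intro j hj
    simp only [ForrMem.occList, List.mem_flatMap, List.mem_ofFn]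
    exact ⟨ForrMem.readsC (C 0), ⟨0, rfl⟩, h j hj⟩
  have hsub : Finset.range n ⊆ ((ForrMem.Rl I).map bitsToNat).toFinset := by
    intro j hj
    rw [List.mem_toFinset, ForrMem.mem_Rl_values_iff]
    exact hocc j (Finset.mem_range.1 hj)
  have h1 := Finset.card_le_card hsub
  rw [Finset.card_range, List.toFinset_card_of_nodup (ForrMem.nodup_Rl_values I), List.length_map] at h1
  exact h1

variable (hB2 : ∀ n mons, (E n mons).IsOver B2)
  (heval : ∀ n mons x, (E n mons).eval x = evalMonos n mons x)
  (hreads : ∀ n mons j, j < n → j ∈ ForrMem.readsC (E n mons))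
  (hcubic : ∀ (n : ℕ) (F : List Bool → Bool), IsDegLeFun 3 (truncOf n F))

include heval hcubic in
/-- The emitted circuits compute cubic functions (whatever the input oracle). -/
theorem isDegLeFun_E (n : ℕ) (F : List Bool → Bool) : IsDegLeFun 3 (E n (cubicMonomials n F)).eval := by
  have : (E n (cubicMonomials n F)).eval = truncOf n F := by
    funext x; rw [heval]; rfl
  rw [this]; exact hcubic _ _

include heval in
/-- The junk circuit `E 0 []` computes the constant `false`. -/
theorem isDegLeFun_E_nil : IsDegLeFun 3 (E 0 []).eval := by
  have : (E 0 []).eval = fun _ => false := by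
    funext x; rw [heval]; rfl
  rw [this]; exact isDegLeFun_const 3 false

include hB2 heval hreads hcubic in
/-- **The guarded instance is well formed** whenever `n` is even. -/
theorem guarded_mem_WF (t : Inst) (heven : Even t.1) :
    (⟨t.1, 2, ![E t.1 (cubicMonomials t.1 (evalP (circAt t 0))),
        E t.1 (cubicMonomials t.1 (evalP (circAt t 1)))]⟩ : KForrelationInstance) ∈ WF := by
  refine ⟨?_, rfl, heven, ?_, ?_⟩
  · intro i
    fin_cases i <;> exact hB2 _ _
  · intro i
    fin_cases i <;> exact isDegLeFun_E heval hcubic _ _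
  · exact (n_le_sR _ (fun j hj => by simpa using hreads _ _ j hj)).trans (Nat.le_succ _)

include hB2 heval in
/-- **The junk instance is well formed.** -/
theorem junk_mem_WF : (⟨0, 2, ![E 0 [], E 0 []]⟩ : KForrelationInstance) ∈ WF := by
  refine ⟨?_, rfl, ⟨0, rfl⟩, ?_, Nat.zero_le _⟩
  · intro i
    fin_cases i <;> exact hB2 _ _
  · intro i
    fin_cases i <;> exact isDegLeFun_E_nil heval

/-- A well-formed instance codes a yes-instance of the gapped slice iff its value is `1`, a no-instance otherwise. -/
theorem encode_mem_of_WF {J : KForrelationInstance} (hJ : J ∈ WF) :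
    J.encode ∈ gappedSlice.yes ∨ J.encode ∈ gappedSlice.no := by
  by_cases hv : J.value = 1
  · exact Or.inl ⟨J, ⟨hJ.1, hv, hJ.2.1, hJ.2.2.1, hJ.2.2.2.1⟩, rfl⟩
  · exact Or.inr ⟨J, ⟨hJ, hv⟩, rfl⟩

/-! ### The exact slice is mapped correctly -/

variable (hexact : ∀ (n : ℕ) (f : (Fin n → Bool) → Bool), IsDegLeFun 3 f →
    truncOf n (fun v => f (ForrCode.toInput n v)) = f)

/-- On the exact slice the guard passes: `k = 2`, `n` even, and `|Φ| = 1` leaves at most one idle wire. -/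
theorem guardOK_of_exact (I : KForrelationInstance) (hk : I.k = 2) (heven : Even I.n)
    (hv : I.value = 1 ∨ I.value = -1) : guardOK (instOf I) I.encode.length = true := by
  have habs : (3 : ℝ) / 5 ≤ |I.value| := by
    rcases hv with h | h <;> rw [h] <;> norm_num
  have hn : I.n ≤ I.encode.length + 1 :=
    (SgnForrMem.n_le_of_promise I hk habs).trans (Nat.succ_le_succ (ForrMem.sR_le_length I))
  simp only [guardOK, instOf, hk, heven, hn, decide_true, Bool.and_self]

include heval hexact in
/-- On a cubic instance the emitted circuit `i` computes the function of the input circuit `i`. -/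
theorem eval_E_instOf (I : KForrelationInstance) (i : Fin I.k) (hdeg : IsDegLeFun 3 (I.C i).eval) :
    (E I.n (cubicMonomials I.n (evalP (circAt (instOf I) i)))).eval = (I.C i).eval := by
  have h1 : (E I.n (cubicMonomials I.n (evalP (circAt (instOf I) i)))).eval =
      truncOf I.n (evalP (circAt (instOf I) i)) := by
    funext x; rw [heval]; rfl
  have h2 : evalP (circAt (instOf I) i) = fun v => (I.C i).eval (toInput I.n v) := by
    funext v; rw [circAt_instOf, evalP_pcircOf_eq]
  rw [h1, h2, hexact _ _ hdeg]

include heval hexact in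
/-- **Value preservation on the exact slice** (the guarded instance built from `instOf I`). -/
theorem value_guarded (I : KForrelationInstance) (hk : I.k = 2) (hdeg : ∀ i, IsDegLeFun 3 (I.C i).eval) :
    (⟨(instOf I).1, 2, ![E (instOf I).1 (cubicMonomials (instOf I).1 (evalP (circAt (instOf I) 0))),
        E (instOf I).1 (cubicMonomials (instOf I).1 (evalP (circAt (instOf I) 1)))]⟩ : KForrelationInstance).value =
      I.value := by
  have h0 : (E I.n (cubicMonomials I.n (evalP (circAt (instOf I) 0)))).eval = (I.C (Fin.cast hk.symm 0)).eval := by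
    have := eval_E_instOf heval hexact I (Fin.cast hk.symm 0) (hdeg _)
    simpa using this
  have h1 : (E I.n (cubicMonomials I.n (evalP (circAt (instOf I) 1)))).eval = (I.C (Fin.cast hk.symm 1)).eval := by
    have := eval_E_instOf heval hexact I (Fin.cast hk.symm 1) (hdeg _)
    simpa using this
  rw [KForrelationInstance.value_eq_forrelation hk, KForrelationInstance.value, kForrelationValue_fin_two]
  simp only [Matrix.cons_val_zero, Matrix.cons_val_one]
  change forrelation (E I.n (cubicMonomials I.n (evalP (circAt (instOf I) 0)))).eval
    (E I.n (cubicMonomials I.n (evalP (circAt (instOf I) 1)))).eval = _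
  rw [h0, h1]

end StubGlue

open StubGlue ForrCode in
/-- STUB G (lead's glue = stub C from M, E, F₃): the canonicaliser `x ↦ instE (canonMirror x)` is total into the promise
of `gappedSlice` and maps the exact slice correctly (WF membership incl. `n ≤ #R + 1` from the touch gates; value
preservation on the slice by Möbius exactness; the guard is idle on the slice by `SgnForrMem.n_le_of_promise`). -/
theorem stub_glue :
    ((∀ (n : ℕ) (F : List Bool → Bool), IsDegLeFun 3 (truncOf n F)) ∧
      (∀ (n : ℕ) (f : (Fin n → Bool) → Bool), IsDegLeFun 3 f →
        truncOf n (fun v => f (ForrCode.toInput n v)) = f)) →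
    (∃ E : (n : ℕ) → List (List ℕ) → Circuit (Fin n),
      (∀ n mons, (E n mons).IsOver B2) ∧
      (∀ n mons x, (E n mons).eval x = evalMonos n mons x) ∧
      (∀ n mons j, j < n → j ∈ ForrMem.readsC (E n mons)) ∧
      (∀ n mons, ForrCode.pcircOf (E n mons) = anfPC n mons)) →
    CodeFP strE ForrCode.instE canonMirror →
    ∃ f ∈ FP, (∀ x, f x ∈ gappedSlice.yes ∨ f x ∈ gappedSlice.no) ∧
      Set.MapsTo f slice.yes gappedSlice.yes ∧ Set.MapsTo f slice.no gappedSlice.no := by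
  rintro ⟨hcubic, hexact⟩ ⟨E, hB2, heval, hreads, hmirror⟩ ⟨f, hf, hfx⟩
  -- the image of every string is the code of a well-formed instance
  have hWF : ∀ x, (if guardOK (parse x) x.length then
      (⟨(parse x).1, 2, ![E (parse x).1 (cubicMonomials (parse x).1 (evalP (circAt (parse x) 0))),
        E (parse x).1 (cubicMonomials (parse x).1 (evalP (circAt (parse x) 1)))]⟩ : KForrelationInstance)
      else ⟨0, 2, ![E 0 [], E 0 []]⟩) ∈ WF := by
    intro x
    split_ifs with hg
    · have hg' := hg
      simp only [guardOK, Bool.and_eq_true, decide_eq_true_eq] at hg'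
      exact guarded_mem_WF hB2 heval hreads hcubic _ hg'.2.1
    · exact junk_mem_WF hB2 heval
  have hfx' : ∀ x, f x = (if guardOK (parse x) x.length then
      (⟨(parse x).1, 2, ![E (parse x).1 (cubicMonomials (parse x).1 (evalP (circAt (parse x) 0))),
        E (parse x).1 (cubicMonomials (parse x).1 (evalP (circAt (parse x) 1)))]⟩ : KForrelationInstance)
      else ⟨0, 2, ![E 0 [], E 0 []]⟩).encode := fun x => by
    rw [← instE_canonMirror hmirror x]; exact hfx x
  -- on the exact slice: the guard passes and the value is preserved
  have hslice : ∀ I : KForrelationInstance, I.k = 2 → Even I.n → (∀ i, IsDegLeFun 3 (I.C i).eval) →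
      (I.value = 1 ∨ I.value = -1) → ∃ J : KForrelationInstance, J ∈ WF ∧ J.value = I.value ∧ f I.encode = J.encode := by
    intro I hk heven hdeg hv
    refine ⟨_, ?_, value_guarded heval hexact I hk hdeg, ?_⟩
    · exact guarded_mem_WF hB2 heval hreads hcubic (instOf I) heven
    · rw [hfx', parse_encode, if_pos (guardOK_of_exact I hk heven hv)]
  refine ⟨f, hf, fun x => ?_, ?_, ?_⟩
  · rw [hfx']
    exact encode_mem_of_WF (hWF x)
  · rintro x ⟨I, ⟨-, hv, hk, heven, hdeg⟩, rfl⟩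
    obtain ⟨J, hJ, hJv, hfJ⟩ := hslice I hk heven hdeg (Or.inl hv)
    rw [hfJ]
    exact ⟨J, ⟨hJ.1, hJv.trans hv, hJ.2.1, hJ.2.2.1, hJ.2.2.2.1⟩, rfl⟩
  · rintro x ⟨I, ⟨-, hv, hk, heven, hdeg⟩, rfl⟩
    obtain ⟨J, hJ, hJv, hfJ⟩ := hslice I hk heven hdeg (Or.inr hv)
    rw [hfJ]
    refine ⟨J, ⟨hJ, ?_⟩, rfl⟩
    rw [hJv, hv]; norm_num

end Summit.QuantumAdvantage.QuantumAdvantage.Theorems.SignedExactSliceIsLift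

end
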